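import Literature.AnabelianGeometry.SemiGraphs.Example28CoverticialLoopCounterexample
import Literature.AnabelianGeometry.SemiGraphs.Example28CoverticialNecessity
import Literature.AnabelianGeometry.Anabelioids.FiniteEtaleLocalDictionaryStabilizer
import HarnessLib

/-!
# [SemiAnbd] Example 2.8, coverticial half — the universally-sub-coverticial clause, sufficiency

Mochizuki, *Semi-graphs of anabelioids*, Publ. RIMS **42** (2006) 221–322, §2, Example 2.8, author's
manuscript p. 31 [cite: MochizukiSemiAnbd2006, Ex. 2.8 p.31]: if `𝒢_e` is trivial for all edges `e`,
"a closed edge abutting to vertices `v`, `w` is … universally sub-coverticial if [and only if] both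
`Π_v` and `Π_w` are infinite".

PROOF-ONLY companion (abc-iut cell, layer L3, row W4-31; named fact
`SemiGraphOfAnabelioids.example_2_8_coverticial` of `Coverticial.lean` rev 4, FACT-LIST F-1474,
statement owner abc-iut-L3-t1; sequel of `Example28CoverticialProofs` / `…LoopCounterexample` /
`…Necessity`).  The "if" direction of the SECOND conjunct holds AS TYPED (loops included):

* `SemiGraphOfAnabelioids.HasTrivialEdgeAnabelioids.of_isFiniteEtaleCoveringOf` — trivial edge
  anabelioids pass to finite étale coverings (the edge constituents of `𝒢'` are the slices
  `(𝒢_e)_Q`, whose `π₁` injects into `Π_e = 1`: abc-iut-L6-t17's `pi1Map_injective_of_star_comp`);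
* `SemiGraphOfAnabelioids.infinite_aut_of_isFiniteEtaleCoveringOf` — over a vertex with infinite
  `Π_v` the vertices of a finite étale covering have infinite `Π_{v'}` (`Π_{v'}` is the stabiliser of
  a point of the fibre of the connected `cV v' ⊆ S_v`, abc-iut-L6-t17's `range_pi1Map_eq_stabilizer`,
  a subgroup of finite index);
* `SemiGraphOfAnabelioids.isUniversallySubCoverticial_of_infinite` — trivial edge anabelioids,
  `e` joins `v`, `w`, `Π_v` and `Π_w` infinite ⇒ `e` is universally sub-coverticial: every edge
  `e''` over `e` of every finite étale covering `𝒢'' → 𝒢` is closed, joins vertices over `v`, `w` with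
  (infinite, hence) nontrivial groups, and `𝒢''` has trivial edge anabelioids, so `e''` is
  sub-coverticial by `isSubCoverticial_of_nontrivial` — also when `e''` is a loop.

No definition; nothing here takes a side on [IUTchIII] Cor. 3.12.
-/

namespace Literature.AnabelianGeometry.SemiGraphs

open CategoryTheory CategoryTheory.Limits CategoryTheory.PreGaloisCategory
open Literature.AnabelianGeometry.Anabelioids

universe v₁ u₁ u

namespace SemiGraphOfAnabelioids

variable {𝒢 𝒢' : SemiGraphOfAnabelioids.{v₁, u₁, u}}

/-- **Trivial edge anabelioids pass to finite étale coverings**: if every `𝒢_e` is trivial and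
`φ : 𝒢' → 𝒢` is the finite étale covering attached to an object of `B(𝒢)` (local description), then
every `𝒢'_{e'}` is trivial — `π₁((𝒢_e)_Q) ↪ π₁(𝒢_e) = 1`.
[cite: MochizukiSemiAnbd2006, Def. 2.2(i) p.23] -/
theorem HasTrivialEdgeAnabelioids.of_isFiniteEtaleCoveringOf (hE : 𝒢.HasTrivialEdgeAnabelioids)
    {φ : Hom 𝒢' 𝒢} {A : 𝒢.BObj} (hφ : φ.IsFiniteEtaleCoveringOf A) :
    𝒢'.HasTrivialEdgeAnabelioids := by
  obtain ⟨-, cV, cE, -, -, -, hEα, -⟩ := hφ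
  refine ⟨fun e' F _ => ?_⟩
  obtain ⟨α, hα, ⟨eQ⟩⟩ := hEα e'
  haveI := hα
  let Q := (φ.φE e' (φ.base.edgeMap e') rfl).pullback
  haveI : FiberFunctor (Q ⋙ F) := fiberFunctor_comp_of_exact _ _
  haveI : Subsingleton (Aut (Q ⋙ F)) := hE.subsingleton _ _
  exact (pi1Map_injective_of_star_comp α eQ F).subsingleton

/-- **Over a vertex with infinite `Π_v`, the vertex groups of a finite étale covering are infinite**
([SemiAnbd] Rem. 2.2.1: `Π_{v'}` is the stabiliser of a pro-vertex, a subgroup of finite index):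
for the covering attached to `A` and a vertex `v'` over `u` with `Π_u` infinite at every basepoint,
`Π_{v'}` is infinite at every basepoint. [cite: MochizukiSemiAnbd2006, Rem. 2.2.1 p.24] -/
theorem infinite_aut_of_isFiniteEtaleCoveringOf {φ : Hom 𝒢' 𝒢} {A : 𝒢.BObj}
    (hφ : φ.IsFiniteEtaleCoveringOf A) (v' : 𝒢'.graph.Vertex) {u : 𝒢.graph.Vertex}
    (hu : φ.base.vertexMap v' = u)
    (hinf : ∀ (G : 𝒢.V u ⥤ FintypeCat.{v₁}) [FiberFunctor G], Infinite (Aut G))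
    (F : 𝒢'.V v' ⥤ FintypeCat.{v₁}) [FiberFunctor F] : Infinite (Aut F) := by
  subst hu
  obtain ⟨-, cV, cE, -, -, hVα, -, -⟩ := hφ
  obtain ⟨α, hα, ⟨eQ⟩⟩ := hVα v'
  haveI := hα
  haveI : PreGaloisCategory.IsConnected ((cV v').1 : 𝒢.V (φ.base.vertexMap v')) := (cV v').2
  let Q := (φ.φV v').pullback
  haveI : FiberFunctor (Q ⋙ F) := fiberFunctor_comp_of_exact _ _
  haveI : Infinite (Aut (Q ⋙ F)) := hinf _
  let S₀ : 𝒢.V (φ.base.vertexMap v') := (cV v').1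
  have hT : IsTerminal (α.obj (Over.mk (𝟙 S₀))) := Over.mkIdTerminal.isTerminalObj α _
  obtain ⟨t₀⟩ := (nonempty_equiv_fiber_terminal_punit F).map fun eq => eq.symm PUnit.unit
  let t : F.obj (α.obj (Over.mk (𝟙 S₀))) := F.map (hT.uniqueUpToIso terminalIsTerminal).inv t₀
  -- the image of `π₁(φ_{v'})` is a stabiliser of finite index in the infinite `Aut (Q ⋙ F)`
  have hrange := range_pi1Map_eq_stabilizer α eQ F (Iso.refl (Q ⋙ F)) t
  set H := ((Aut.autMulEquivOfIso (Iso.refl (Q ⋙ F))).toMonoidHom.comp (pi1Map Q F)).range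
  have hidx : H.FiniteIndex := by
    rw [hrange]
    refine ⟨?_⟩
    rw [index_stabilizer_fiber]
    exact Nat.card_pos.ne'
  have hH : Infinite H := by
    by_contra hfin
    rw [not_infinite_iff_finite] at hfin
    exact Infinite.not_finite ((Subgroup.finite_iff_finite_and_finiteIndex H).mpr ⟨hfin, hidx⟩)
  -- and `Aut F` surjects onto it
  exact Infinite.of_surjective (fun σ : Aut F => (⟨_, σ, rfl⟩ : H)) fun ⟨x, σ, hσ⟩ => ⟨σ, Subtype.ext hσ⟩

/-- **[SemiAnbd] Example 2.8, coverticial half, second conjunct — sufficiency AS TYPED** (p. 31: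
"… universally sub-coverticial if [and only if] both `Π_v` and `Π_w` are infinite", the "if"
direction, loops `v = w` included): for `𝒢` with trivial edge anabelioids and a closed edge `e`
joining `v` to `w`, if `Π_v` and `Π_w` are infinite (at every basepoint) then `e` is universally
sub-coverticial. [cite: MochizukiSemiAnbd2006, Ex. 2.8 p.31] -/
theorem isUniversallySubCoverticial_of_infinite (hE : 𝒢.HasTrivialEdgeAnabelioids)
    {e : 𝒢.graph.Edge} {v w : 𝒢.graph.Vertex} (hj : 𝒢.graph.Joins e v w)
    (hv : ∀ (F : 𝒢.V v ⥤ FintypeCat.{v₁}) [FiberFunctor F], Infinite (Aut F))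
    (hw : ∀ (F : 𝒢.V w ⥤ FintypeCat.{v₁}) [FiberFunctor F], Infinite (Aut F)) :
    𝒢.IsUniversallySubCoverticial e := by
  obtain ⟨b₁, b₂, hb12, hb₁, hb₂, ha₁, ha₂⟩ := hj
  have he : 𝒢.graph.IsClosedEdge e := SemiGraph.isClosedEdge_of_abuts hb12 hb₁ hb₂ ha₁ ha₂
  refine ⟨he, fun 𝒢'' φ hφ e'' he'' => ?_⟩
  obtain ⟨A, hloc, -, -, -⟩ := hφ
  have hprop : SemiGraph.IsProper φ.base := hloc.1
  -- the two branches of `e''`, over `b₁` and `b₂`, abut to vertices over `v` and `w`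
  obtain ⟨β₁, x₁, hβ₁e, hβ₁b, hβ₁x, hx₁⟩ :=
    SemiGraph.exists_branch_preimage_abuts φ.base hprop e'' b₁ (by rw [he'', hb₁]) v ha₁
  obtain ⟨β₂, x₂, hβ₂e, hβ₂b, hβ₂x, hx₂⟩ :=
    SemiGraph.exists_branch_preimage_abuts φ.base hprop e'' b₂ (by rw [he'', hb₂]) w ha₂
  have hβ12 : β₁ ≠ β₂ := fun h => hb12 (by rw [← hβ₁b, ← hβ₂b, h])
  -- the covering has trivial edge anabelioids and infinite vertex groups over `v`, `w`
  have hE'' : 𝒢''.HasTrivialEdgeAnabelioids := hE.of_isFiniteEtaleCoveringOf hloc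
  haveI hx₁inf : ∀ (F : 𝒢''.V x₁ ⥤ FintypeCat.{v₁}) [FiberFunctor F], Infinite (Aut F) :=
    fun F _ => infinite_aut_of_isFiniteEtaleCoveringOf hloc x₁ hx₁ hv F
  haveI hx₂inf : ∀ (F : 𝒢''.V x₂ ⥤ FintypeCat.{v₁}) [FiberFunctor F], Infinite (Aut F) :=
    fun F _ => infinite_aut_of_isFiniteEtaleCoveringOf hloc x₂ hx₂ hw F
  exact isSubCoverticial_of_nontrivial hE'' ⟨β₁, β₂, hβ12, hβ₁e, hβ₂e, hβ₁x, hβ₂x⟩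
    (fun F _ => by haveI := hx₁inf F; infer_instance)
    (fun F _ => by haveI := hx₂inf F; infer_instance)

end SemiGraphOfAnabelioids

end Literature.AnabelianGeometry.SemiGraphs
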